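import Mathlib.Combinatorics.Colex
import Summits.ValiantsHypothesis.ValiantsHypothesis.Theorems.KPlusLogSqLawTropicalBConcatenation

/-!
# Route `KPlusLogSqLaw`, crux `TropicalB` — chain surgery tools: APPENDING two chains of one design, and GENERIC RESCALING of a
# design (same chain, plus unique optima at all far-left and all far-right slopes)

HONEST FRAMING.  Helper file toward the registered stubs `stub_tropThin` / `stub_tropFat` of
`Cruxes/TropicalB/Lines/birth.lean` (crux `Summit.ValiantsHypothesis.ValiantsHypothesis.Theses.KPlusLogSqLaw.TropicalB`,
ledger item `stmt-ValiantsHypothesis-19771`, route `KPlusLogSqLaw`; cell `pub-symmetroid`, seat `val-sym-trop-p4` g6,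
2026-08-27).  Two design-surgery tools used by the size-superadditivity theorem (companion file …TropicalBBlockSum); nothing
here proves a stub or asserts `TropicalB`, `KPlusLogSqLaw`, `WeakLifting`, `MatrixDescartes` or anything about `VP ≠ VNP`.

* `append_chains` — two sign-alternating dominant chains of the SAME design, the first ending (in slope) before the second
  starts and with an alternating junction, form one chain: `n₁ + n₂ + 1` breakpoints; `append_chains'` — without the junction
  hypothesis one still gets `n₁ + n₂` breakpoints (drop the first term of the second chain if the junction does not alternate).
* `exists_scaled_ends` — GENERIC RESCALING: for every design `(d, v, ε)` with a dominant chain `p₀, …, pₙ` there are new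
  valuations `v'` (namely `S·v + η` with `η(a,b,l) = 2^{code(a,b,l)}` and `S` larger than every `η`-sum of a term) such that the
  same terms form a dominant chain of `(d, v', ε)` at the slopes `S·θₖ`, AND some present term `qL` is the unique optimum at EVERY
  slope `τ ≤ L`, AND some present term `qR` is the unique optimum at every slope `τ ≥ R` (the lexicographic extreme terms: minimal /
  maximal total exponent, then minimal `v'`-sum, unique because the `η`-sums of distinct terms are distinct sums of distinct powers
  of two, `Finset.geomSum_injective`).  This is the genericity needed to run two designs side by side in slope-separated ranges.
[folklore: perturbation to general position; appending parametric families]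
-/

set_option linter.dupNamespace false
set_option autoImplicit false

namespace Summit.ValiantsHypothesis.ValiantsHypothesis.Theorems.KPlusLogSqLaw

open Summit.ValiantsHypothesis.ValiantsHypothesis.Theorems.MatrixDescartes.Negative
open Summit.ValiantsHypothesis.ValiantsHypothesis.Theorems.LacunarySymmetroidMatrixDescartes
open Summit.ValiantsHypothesis.ValiantsHypothesis.Theorems.LacunarySymmetroidMatrixDescartes.TropicalCensus
open scoped BigOperators
open Finset

namespace Concatenation

variable {m K : ℕ}

/-! ## 1. Appending two chains of one design -/

/-- **Appending chains.**  In one design, a sign-alternating dominant chain `p₁` at slopes `θ₁ 0 < ⋯ < θ₁ n₁` followed by a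
sign-alternating dominant chain `p₂` at slopes `θ₂ 0 < ⋯ < θ₂ n₂` with `θ₁ n₁ < θ₂ 0` and an alternating junction
`termSign (p₁ n₁) · termSign (p₂ 0) < 0` is a chain with `n₁ + n₂ + 1` breakpoints: `¬ TropRootLawAt m K (n₁ + n₂)`. [folklore] -/
theorem append_chains (d : Fin K → ℕ) (v ε : Fin m → Fin m → Fin K → ℤ) (hε : ∀ i j l, (ε i j l).natAbs ≤ 1)
    {n₁ n₂ : ℕ} (θ₁ : Fin (n₁ + 1) → ℤ) (p₁ : Fin (n₁ + 1) → Equiv.Perm (Fin m) × (Fin m → Fin K))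
    (θ₂ : Fin (n₂ + 1) → ℤ) (p₂ : Fin (n₂ + 1) → Equiv.Perm (Fin m) × (Fin m → Fin K))
    (hθ₁ : StrictMono θ₁) (hθ₂ : StrictMono θ₂) (hlt : θ₁ (Fin.last n₁) < θ₂ 0)
    (hdom₁ : ∀ k, IsDominant d v ε (θ₁ k) (p₁ k)) (hdom₂ : ∀ k, IsDominant d v ε (θ₂ k) (p₂ k))
    (halt₁ : ∀ k : Fin n₁, termSign ε (p₁ k.castSucc) * termSign ε (p₁ k.succ) < 0)
    (halt₂ : ∀ k : Fin n₂, termSign ε (p₂ k.castSucc) * termSign ε (p₂ k.succ) < 0)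
    (hj : termSign ε (p₁ (Fin.last n₁)) * termSign ε (p₂ 0) < 0) : ¬ TropRootLawAt m K (n₁ + n₂) := by
  intro h
  set n : ℕ := n₁ + n₂ + 1 with hn
  obtain ⟨θG, hθG⟩ : ∃ θG : Fin (n + 1) → ℤ, ∀ k, θG k =
      if hk : (k : ℕ) ≤ n₁ then θ₁ ⟨k, Nat.lt_succ_of_le hk⟩
      else θ₂ ⟨(k : ℕ) - (n₁ + 1), by have := k.isLt; omega⟩ := ⟨_, fun _ => rfl⟩
  obtain ⟨pG, hpG⟩ : ∃ pG : Fin (n + 1) → Equiv.Perm (Fin m) × (Fin m → Fin K), ∀ k, pG k =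
      if hk : (k : ℕ) ≤ n₁ then p₁ ⟨k, Nat.lt_succ_of_le hk⟩
      else p₂ ⟨(k : ℕ) - (n₁ + 1), by have := k.isLt; omega⟩ := ⟨_, fun _ => rfl⟩
  have hθG_A : ∀ (k : Fin (n + 1)) (k' : Fin (n₁ + 1)), (k : ℕ) = (k' : ℕ) → θG k = θ₁ k' := fun k k' hkk' => by
    have hk : (k : ℕ) ≤ n₁ := by have := k'.isLt; omega
    rw [hθG, dif_pos hk]; congr 1; exact Fin.ext hkk'
  have hθG_B : ∀ (k : Fin (n + 1)) (j : Fin (n₂ + 1)), (k : ℕ) = n₁ + 1 + j → θG k = θ₂ j := fun k j hkj => by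
    have hk : ¬ (k : ℕ) ≤ n₁ := by omega
    rw [hθG, dif_neg hk]; congr 1; exact Fin.ext (show (k : ℕ) - (n₁ + 1) = (j : ℕ) by omega)
  have hpG_A : ∀ (k : Fin (n + 1)) (k' : Fin (n₁ + 1)), (k : ℕ) = (k' : ℕ) → pG k = p₁ k' := fun k k' hkk' => by
    have hk : (k : ℕ) ≤ n₁ := by have := k'.isLt; omega
    rw [hpG, dif_pos hk]; congr 1; exact Fin.ext hkk'
  have hpG_B : ∀ (k : Fin (n + 1)) (j : Fin (n₂ + 1)), (k : ℕ) = n₁ + 1 + j → pG k = p₂ j := fun k j hkj => by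
    have hk : ¬ (k : ℕ) ≤ n₁ := by omega
    rw [hpG, dif_neg hk]; congr 1; exact Fin.ext (show (k : ℕ) - (n₁ + 1) = (j : ℕ) by omega)
  have hsplit : ∀ k : Fin (n + 1), (∃ k' : Fin (n₁ + 1), (k : ℕ) = (k' : ℕ)) ∨
      (∃ j : Fin (n₂ + 1), (k : ℕ) = n₁ + 1 + j) := fun k => by
    by_cases hk : (k : ℕ) ≤ n₁
    · exact Or.inl ⟨⟨k, Nat.lt_succ_of_le hk⟩, rfl⟩
    · exact Or.inr ⟨⟨(k : ℕ) - (n₁ + 1), by have := k.isLt; omega⟩, by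
        show (k : ℕ) = n₁ + 1 + ((k : ℕ) - (n₁ + 1)); omega⟩
  have hθGmono : StrictMono θG := fun a b hab => by
    have hab' : (a : ℕ) < (b : ℕ) := hab
    rcases hsplit a with ⟨a', ha'⟩ | ⟨ja, hja⟩ <;> rcases hsplit b with ⟨b', hb'⟩ | ⟨jb, hjb⟩
    · rw [hθG_A a a' ha', hθG_A b b' hb']
      exact hθ₁ (Fin.mk_lt_mk.mpr (show (a' : ℕ) < b' by omega))
    · rw [hθG_A a a' ha', hθG_B b jb hjb]
      have h1 : θ₁ a' ≤ θ₁ (Fin.last n₁) := hθ₁.monotone (Fin.le_last _)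
      have h2 : θ₂ 0 ≤ θ₂ jb := hθ₂.monotone (Fin.zero_le _)
      linarith only [h1, h2, hlt]
    · exfalso; have := b'.isLt; omega
    · rw [hθG_B a ja hja, hθG_B b jb hjb]
      exact hθ₂ (Fin.mk_lt_mk.mpr (show (ja : ℕ) < jb by omega))
  have hdomG : ∀ k, IsDominant d v ε (θG k) (pG k) := fun k => by
    rcases hsplit k with ⟨k', hk'⟩ | ⟨j, hj⟩
    · rw [hθG_A k k' hk', hpG_A k k' hk']; exact hdom₁ _
    · rw [hθG_B k j hj, hpG_B k j hj]; exact hdom₂ _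
  have haltG : ∀ k : Fin n, termSign ε (pG k.castSucc) * termSign ε (pG k.succ) < 0 := fun k => by
    have hkc : ((k.castSucc : Fin (n + 1)) : ℕ) = (k : ℕ) := Fin.val_castSucc k
    have hks : ((k.succ : Fin (n + 1)) : ℕ) = (k : ℕ) + 1 := Fin.val_succ k
    by_cases h1 : (k : ℕ) + 1 ≤ n₁
    · set k' : Fin n₁ := ⟨k, by omega⟩ with hk'
      rw [hpG_A k.castSucc k'.castSucc (by rw [hkc, Fin.val_castSucc]), hpG_A k.succ k'.succ (by rw [hks, Fin.val_succ])]
      exact halt₁ k'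
    · by_cases h0 : (k : ℕ) ≤ n₁
      · have hkn : (k : ℕ) = n₁ := by omega
        rw [hpG_A k.castSucc (Fin.last n₁) (by rw [hkc, Fin.val_last, hkn]), hpG_B k.succ 0 (by rw [hks, Fin.val_zero, hkn])]
        exact hj
      · have hjv : (k : ℕ) - (n₁ + 1) < n₂ := by have := k.isLt; omega
        set j : Fin n₂ := ⟨(k : ℕ) - (n₁ + 1), hjv⟩ with hjdef
        have hjv' : (j : ℕ) = (k : ℕ) - (n₁ + 1) := rfl
        rw [hpG_B k.castSucc j.castSucc (by rw [hkc, Fin.val_castSucc, hjv']; omega),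
          hpG_B k.succ j.succ (by rw [hks, Fin.val_succ, hjv']; omega)]
        exact halt₂ j
  have := h d v ε n θG pG hε hθGmono hdomG haltG
  omega

/-- **Appending chains without a junction hypothesis**: `n₁ + n₂` breakpoints survive (if the junction does not alternate, the
first term of the second chain is dropped; its second term then alternates with the last term of the first chain). [folklore] -/
theorem append_chains' (d : Fin K → ℕ) (v ε : Fin m → Fin m → Fin K → ℤ) (hε : ∀ i j l, (ε i j l).natAbs ≤ 1)
    {n₁ n₂ : ℕ} (hn₂ : 1 ≤ n₂) (θ₁ : Fin (n₁ + 1) → ℤ) (p₁ : Fin (n₁ + 1) → Equiv.Perm (Fin m) × (Fin m → Fin K))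
    (θ₂ : Fin (n₂ + 1) → ℤ) (p₂ : Fin (n₂ + 1) → Equiv.Perm (Fin m) × (Fin m → Fin K))
    (hθ₁ : StrictMono θ₁) (hθ₂ : StrictMono θ₂) (hlt : θ₁ (Fin.last n₁) < θ₂ 0)
    (hdom₁ : ∀ k, IsDominant d v ε (θ₁ k) (p₁ k)) (hdom₂ : ∀ k, IsDominant d v ε (θ₂ k) (p₂ k))
    (halt₁ : ∀ k : Fin n₁, termSign ε (p₁ k.castSucc) * termSign ε (p₁ k.succ) < 0)
    (halt₂ : ∀ k : Fin n₂, termSign ε (p₂ k.castSucc) * termSign ε (p₂ k.succ) < 0) :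
    ¬ TropRootLawAt m K (n₁ + n₂ - 1) := by
  by_cases hj : termSign ε (p₁ (Fin.last n₁)) * termSign ε (p₂ 0) < 0
  · intro h
    exact append_chains d v ε hε θ₁ p₁ θ₂ p₂ hθ₁ hθ₂ hlt hdom₁ hdom₂ halt₁ halt₂ hj (tropRootLawAt_mono (by omega) h)
  · -- drop the first term of the second chain
    obtain ⟨n₂', rfl⟩ : ∃ n₂', n₂ = n₂' + 1 := ⟨n₂ - 1, by omega⟩
    have h01 := halt₂ 0
    have hj' : termSign ε (p₁ (Fin.last n₁)) * termSign ε (p₂ (Fin.succ 0)) < 0 := by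
      have hne₁ : termSign ε (p₁ (Fin.last n₁)) ≠ 0 := (hdom₁ _).1
      have hne₂ : termSign ε (p₂ 0) ≠ 0 := (hdom₂ _).1
      have hpos : 0 < termSign ε (p₁ (Fin.last n₁)) * termSign ε (p₂ 0) :=
        lt_of_le_of_ne (not_lt.mp hj) (Ne.symm (mul_ne_zero hne₁ hne₂))
      have e0 : p₂ (Fin.castSucc 0) = p₂ 0 := rfl
      rw [e0] at h01
      have hsq : 0 < termSign ε (p₂ 0) * termSign ε (p₂ 0) := mul_self_pos.mpr hne₂
      have hprod : (termSign ε (p₁ (Fin.last n₁)) * termSign ε (p₂ (Fin.succ 0))) *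
          (termSign ε (p₂ 0) * termSign ε (p₂ 0)) < 0 := by
        have := mul_neg_of_pos_of_neg hpos h01
        linarith only [this, show (termSign ε (p₁ (Fin.last n₁)) * termSign ε (p₂ (Fin.succ 0))) *
          (termSign ε (p₂ 0) * termSign ε (p₂ 0)) = (termSign ε (p₁ (Fin.last n₁)) * termSign ε (p₂ 0)) *
          (termSign ε (p₂ 0) * termSign ε (p₂ (Fin.succ 0))) by ring]
      by_contra hge
      push Not at hge
      have := mul_nonneg hge hsq.le
      linarith only [this, hprod]
    have hθ₂' : StrictMono (fun j : Fin (n₂' + 1) => θ₂ j.succ) := fun a b hab => hθ₂ (Fin.succ_lt_succ_iff.mpr hab)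
    have hlt' : θ₁ (Fin.last n₁) < θ₂ (Fin.succ 0) := lt_trans hlt (hθ₂ (Fin.succ_pos 0))
    have halt₂' : ∀ k : Fin n₂', termSign ε (p₂ (Fin.succ k.castSucc)) * termSign ε (p₂ (Fin.succ k.succ)) < 0 := by
      intro k
      have := halt₂ k.succ
      have e1 : (k.succ).castSucc = k.castSucc.succ := Fin.ext (by simp)
      rw [e1] at this
      exact this
    have := append_chains d v ε hε θ₁ p₁ (fun j => θ₂ j.succ) (fun j => p₂ j.succ) hθ₁ hθ₂' hlt' hdom₁
      (fun k => hdom₂ _) halt₁ halt₂' hj'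
    rwa [show n₁ + (n₂' + 1) - 1 = n₁ + n₂' by omega]

/-! ## 2. Generic rescaling: the same chain, plus unique optima at all far-left and all far-right slopes -/

/-- the `v`-sum of a term. -/
theorem tropWeight_eq_slope_sub (d : Fin K → ℕ) (v : Fin m → Fin m → Fin K → ℤ) (θ : ℤ)
    (q : Equiv.Perm (Fin m) × (Fin m → Fin K)) :
    tropWeight d v θ q = θ * (∑ i, (d (q.2 i) : ℤ)) - ∑ i, v (q.1 i) i (q.2 i) := rfl

/-- **Generic rescaling with extreme optima.**  Given a design `(d, v, ε)` of format `(m, K)` (`m ≥ 1`) and a dominant chain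
`p₀, …, pₙ` at strictly increasing slopes, there are valuations `v'`, strictly increasing slopes `θ'`, present terms `qL, qR` and
thresholds `L, R` such that: the `pₖ` are dominant in `(d, v', ε)` at `θ'ₖ`; `qL` is dominant at every `τ ≤ L`; `qR` is dominant at
every `τ ≥ R`.  (`v' = S·v + η` with `η(a,b,l) = 2^{code(a,b,l)}`, `S` exceeding every `η`-sum of a term.) [folklore] -/
theorem exists_scaled_ends (hm : 0 < m) (d : Fin K → ℕ) (v ε : Fin m → Fin m → Fin K → ℤ) {n : ℕ}
    (θ : Fin (n + 1) → ℤ) (p : Fin (n + 1) → Equiv.Perm (Fin m) × (Fin m → Fin K))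
    (hθ : StrictMono θ) (hdom : ∀ k, IsDominant d v ε (θ k) (p k)) :
    ∃ (v' : Fin m → Fin m → Fin K → ℤ) (θ' : Fin (n + 1) → ℤ) (qL qR : Equiv.Perm (Fin m) × (Fin m → Fin K)) (L R : ℤ),
      StrictMono θ' ∧ (∀ k, IsDominant d v' ε (θ' k) (p k)) ∧
      (∀ τ, τ ≤ L → IsDominant d v' ε τ qL) ∧ (∀ τ, R ≤ τ → IsDominant d v' ε τ qR) := by
  classical
  -- an injective code of the incidences and the perturbation `η`
  set code : Fin m → Fin m → Fin K → ℕ := fun a b l => (Fintype.equivFin (Fin m × Fin m × Fin K) (a, b, l) : ℕ) with hcode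
  have hcode_inj : ∀ a b l a' b' l', code a b l = code a' b' l' → a = a' ∧ b = b' ∧ l = l' := by
    intro a b l a' b' l' h
    have h1 : (Fintype.equivFin (Fin m × Fin m × Fin K) (a, b, l)) = Fintype.equivFin _ (a', b', l') := Fin.ext h
    have h2 := (Fintype.equivFin (Fin m × Fin m × Fin K)).injective h1
    simp only [Prod.mk.injEq] at h2
    exact ⟨h2.1, h2.2.1, h2.2.2⟩
  set N : ℕ := Fintype.card (Fin m × Fin m × Fin K) with hN
  have hcode_lt : ∀ a b l, code a b l < N := fun a b l => (Fintype.equivFin _ (a, b, l)).isLt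
  obtain ⟨ηT, hηT⟩ : ∃ ηT : (Equiv.Perm (Fin m) × (Fin m → Fin K)) → ℕ,
      ∀ q, ηT q = ∑ i, 2 ^ code (q.1 i) i (q.2 i) := ⟨_, fun _ => rfl⟩
  -- `ηT` is injective: a term is determined by its set of incidence codes
  have hηT_set : ∀ q : Equiv.Perm (Fin m) × (Fin m → Fin K),
      ηT q = ∑ x ∈ univ.image (fun i => code (q.1 i) i (q.2 i)), 2 ^ x := by
    intro q
    rw [hηT, sum_image]
    intro i _ i' _ h
    exact (hcode_inj _ _ _ _ _ _ h).2.1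
  have hηT_inj : ∀ q q' : Equiv.Perm (Fin m) × (Fin m → Fin K), ηT q = ηT q' → q = q' := by
    intro q q' h
    rw [hηT_set, hηT_set] at h
    have hs := Finset.geomSum_injective (le_refl 2) h
    have key : ∀ i, q.1 i = q'.1 i ∧ q.2 i = q'.2 i := by
      intro i
      have hi : code (q.1 i) i (q.2 i) ∈ univ.image (fun i => code (q'.1 i) i (q'.2 i)) := by
        rw [← hs]; exact mem_image_of_mem _ (mem_univ i)
      obtain ⟨i', _, hi'⟩ := mem_image.mp hi
      obtain ⟨h1, h2, h3⟩ := hcode_inj _ _ _ _ _ _ hi'.symm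
      subst h2
      exact ⟨h1, h3⟩
    exact Prod.ext (Equiv.ext fun i => (key i).1) (funext fun i => (key i).2)
  -- `ηT < m·2^N + 1 =: S`
  have hηT_lt : ∀ q, ηT q < m * 2 ^ N + 1 := by
    intro q
    have : ηT q ≤ ∑ _i : Fin m, 2 ^ N := by
      rw [hηT]; exact sum_le_sum fun i _ => Nat.pow_le_pow_right (by norm_num) (hcode_lt _ _ _).le
    rw [sum_const, card_univ, Fintype.card_fin, smul_eq_mul] at this
    omega
  set S : ℤ := m * 2 ^ N + 1 with hS
  have hS0 : 0 < S := by positivity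
  have hηS : ∀ q, ((ηT q : ℕ) : ℤ) < S := fun q => by rw [hS]; exact_mod_cast hηT_lt q
  -- the rescaled design
  obtain ⟨v', hv'⟩ : ∃ v' : Fin m → Fin m → Fin K → ℤ, ∀ a b l, v' a b l = S * v a b l + 2 ^ code a b l := ⟨_, fun _ _ _ => rfl⟩
  obtain ⟨V, hV⟩ : ∃ V : (Equiv.Perm (Fin m) × (Fin m → Fin K)) → ℤ, ∀ q, V q = ∑ i, v (q.1 i) i (q.2 i) :=
    ⟨_, fun _ => rfl⟩
  obtain ⟨V', hV'⟩ : ∃ V' : (Equiv.Perm (Fin m) × (Fin m → Fin K)) → ℤ, ∀ q, V' q = ∑ i, v' (q.1 i) i (q.2 i) :=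
    ⟨_, fun _ => rfl⟩
  obtain ⟨sl, hsl⟩ : ∃ sl : (Equiv.Perm (Fin m) × (Fin m → Fin K)) → ℤ, ∀ q, sl q = ∑ i, (d (q.2 i) : ℤ) :=
    ⟨_, fun _ => rfl⟩
  have hV'eq : ∀ q, V' q = S * V q + ((ηT q : ℕ) : ℤ) := by
    intro q
    rw [hV', hV, hηT, mul_sum]
    push_cast
    rw [← sum_add_distrib]
    exact sum_congr rfl fun i _ => by rw [hv']
  have hw : ∀ q τ, tropWeight d v τ q = τ * sl q - V q := fun q τ => by rw [hsl, hV]; rfl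
  have hw' : ∀ q τ, tropWeight d v' τ q = τ * sl q - V' q := fun q τ => by rw [hsl, hV']; rfl
  -- (a) the chain survives at slopes `S·θ`
  have hchain : ∀ k, IsDominant d v' ε (S * θ k) (p k) := by
    intro k
    refine ⟨(hdom k).1, fun q hq hqs => ?_⟩
    have hlt := (hdom k).2 q hq hqs
    rw [hw, hw] at hlt
    rw [hw', hw', hV'eq, hV'eq]
    have h1 : θ k * sl q - V q + 1 ≤ θ k * sl (p k) - V (p k) := hlt
    have h2 := hηS (p k)
    have h3 : (0 : ℤ) ≤ ((ηT q : ℕ) : ℤ) := by positivity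
    nlinarith [h1, h2, h3, hS0]
  -- a bound on all `|V'|`
  obtain ⟨W, hW⟩ := exists_abs_le fun q : Equiv.Perm (Fin m) × (Fin m → Fin K) => V' q
  -- (b) the far-left optimum: minimal slope, then minimal `V'`, among present terms
  set Pr : Finset (Equiv.Perm (Fin m) × (Fin m → Fin K)) := univ.filter fun q => termSign ε q ≠ 0 with hPr
  have hPr_ne : Pr.Nonempty := ⟨p 0, by rw [hPr, mem_filter]; exact ⟨mem_univ _, (hdom 0).1⟩⟩
  have hmemPr : ∀ q, q ∈ Pr ↔ termSign ε q ≠ 0 := fun q => by rw [hPr, mem_filter]; simp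
  obtain ⟨qmin, hqmin_mem, hqmin⟩ := exists_min_image Pr sl hPr_ne
  set M : Finset _ := Pr.filter fun q => sl q = sl qmin with hM
  have hM_ne : M.Nonempty := ⟨qmin, by rw [hM, mem_filter]; exact ⟨hqmin_mem, rfl⟩⟩
  obtain ⟨qL, hqL_mem, hqL⟩ := exists_min_image M V' hM_ne
  have hqL_pres : termSign ε qL ≠ 0 := (hmemPr qL).mp (mem_filter.mp hqL_mem).1
  have hqL_sl : sl qL = sl qmin := (mem_filter.mp hqL_mem).2
  -- (c) the far-right optimum: maximal slope, then minimal `V'`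
  obtain ⟨qmax, hqmax_mem, hqmax⟩ := exists_max_image Pr sl hPr_ne
  set M' : Finset _ := Pr.filter fun q => sl q = sl qmax with hM'
  have hM'_ne : M'.Nonempty := ⟨qmax, by rw [hM', mem_filter]; exact ⟨hqmax_mem, rfl⟩⟩
  obtain ⟨qR, hqR_mem, hqR⟩ := exists_min_image M' V' hM'_ne
  have hqR_pres : termSign ε qR ≠ 0 := (hmemPr qR).mp (mem_filter.mp hqR_mem).1
  have hqR_sl : sl qR = sl qmax := (mem_filter.mp hqR_mem).2
  -- distinct terms have distinct `V'` (the `η`-sums differ and `S` exceeds them)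
  have hV'inj : ∀ q q', V' q = V' q' → q = q' := by
    intro q q' h
    rw [hV'eq, hV'eq] at h
    apply hηT_inj
    have h1 := hηS q
    have h2 := hηS q'
    have h3 : (0 : ℤ) ≤ ((ηT q : ℕ) : ℤ) := by positivity
    have h4 : (0 : ℤ) ≤ ((ηT q' : ℕ) : ℤ) := by positivity
    have h5 : S * (V q - V q') = ((ηT q' : ℕ) : ℤ) - ((ηT q : ℕ) : ℤ) := by linarith
    have h6 : V q - V q' = 0 := by
      by_contra hne
      rcases lt_or_gt_of_ne hne with hlt | hgt
      · have : S * (V q - V q') ≤ -S := by nlinarith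
        linarith
      · have : S ≤ S * (V q - V q') := by nlinarith
        linarith
    have : ((ηT q : ℕ) : ℤ) = ((ηT q' : ℕ) : ℤ) := by rw [h6, mul_zero] at h5; linarith
    exact_mod_cast this
  refine ⟨v', fun k => S * θ k, qL, qR, -(2 * W + 1), 2 * W + 1, fun a b hab => ?_, hchain, fun τ hτ => ?_, fun τ hτ => ?_⟩
  · exact Int.mul_lt_mul_of_pos_left (hθ hab) hS0
  · -- far left
    refine ⟨hqL_pres, fun q hq hqs => ?_⟩
    rw [hw', hw']
    have hq_mem : q ∈ Pr := (hmemPr q).mpr hqs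
    have hsl_le : sl qL ≤ sl q := by rw [hqL_sl]; exact hqmin q hq_mem
    have hWq := abs_le.mp (hW q)
    have hWL := abs_le.mp (hW qL)
    rcases lt_or_eq_of_le hsl_le with hlt | heq
    · -- larger slope: loses by at least `−τ ≥ 2W + 1`
      have h1 : sl q - sl qL ≥ 1 := by linarith
      nlinarith [h1, hτ, hWq.1, hWq.2, hWL.1, hWL.2]
    · -- same slope: strictly larger `V'`
      have hqM : q ∈ M := by rw [hM, mem_filter]; exact ⟨hq_mem, by rw [← heq, hqL_sl]⟩
      have hle := hqL q hqM
      have hne : V' qL ≠ V' q := fun h => hq (hV'inj _ _ h).symm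
      have hlt : V' qL < V' q := lt_of_le_of_ne hle hne
      rw [heq]; linarith
  · -- far right
    refine ⟨hqR_pres, fun q hq hqs => ?_⟩
    rw [hw', hw']
    have hq_mem : q ∈ Pr := (hmemPr q).mpr hqs
    have hsl_le : sl q ≤ sl qR := by rw [hqR_sl]; exact hqmax q hq_mem
    have hWq := abs_le.mp (hW q)
    have hWR := abs_le.mp (hW qR)
    rcases lt_or_eq_of_le hsl_le with hlt | heq
    · have h1 : sl qR - sl q ≥ 1 := by linarith
      nlinarith [h1, hτ, hWq.1, hWq.2, hWR.1, hWR.2]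
    · have hqM : q ∈ M' := by rw [hM', mem_filter]; exact ⟨hq_mem, by rw [heq, hqR_sl]⟩
      have hle := hqR q hqM
      have hne : V' qR ≠ V' q := fun h => hq (hV'inj _ _ h).symm
      have hlt : V' qR < V' q := lt_of_le_of_ne hle hne
      rw [heq]; linarith

end Concatenation

end Summit.ValiantsHypothesis.ValiantsHypothesis.Theorems.KPlusLogSqLaw
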